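import Summits.AtomisticToContinuum.Crystallization.Theorems.FrustratedLawDichotomyMarginLedger
import Summits.AtomisticToContinuum.Crystallization.Theorems.FrustratedLawDichotomyHardCoreUpgrade

/-!
# FrustratedLawDichotomy · crux `AperiodicFrustratedLawGap` (stmt-AtomisticToContinuum-27623) — T4: THE ATLAS DOOR
# (decomp-a2c, RESIDUAL lens-5 «finite/base range + asymptotic regime + bridge», generation 112; critic r1745 (B)(4), r1747 (C))

The crux BY NAME from (i) a FINITE ROW ATLAS — measurable classes `K i` (`i < n`) of rooted configurations with booked margins `m_i : ℝ` (any sign) and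
DETERMINISTIC floors `e⋆ + m_i ≤ rootEnergy V_LJ μ` for every rooted `7/10`-hard-core, Nash configuration `μ ∈ K i` (this is what the class-A cell files
(T2 `…CoherentFloor.certFloor_le_two_mul_rootEnergy_of_nash`), the halo rows and the class-B budgets deliver, law-free) — and (ii) ONE NAMED RESIDUAL
HYPOTHESIS `ResidualCoreDeficit n K mK`: for every admissible minimising law of the crux (at hard core `7/10`, which clause (d) forces —
`…HardCoreUpgrade.ae_isRootedHardCore_upgrade`), the MEAN DEFICIT of the roots the atlas does not cover is below the credit booked on the first-hit cells
`Σ_{i<n} m_i·P(rowCell K i)`.  Proof: T3 `…MarginLedger.lawLedgerOfRows` + the tree door `…SignedLedger.aperiodicFrustratedLawGap_of_lawLedger`.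

With `n = 0` the residual hypothesis is the crux itself (reading A′: E′ ⟸ hdef alone); every certified row shrinks it.  The residual core of record
(r1747 (C)): class D (no template within `τ_A` in the `7`-ball), the interfaces D∂ («a class-D site within 7 of a non-class-D root»), and whatever the
atlas leaves uncertified — all inside `(⋃ K i)ᶜ` by construction, so the NEXT residual is again this single decl, for a longer row list.
DEFS `ResidualCoreDeficit` (plain `def`; no instance / notation); imports TREE T3 `…MarginLedger` and `…HardCoreUpgrade`; 0 sorry.  Tags: [new: junction].
-/

noncomputable section

namespace Summit.AtomisticToContinuum.Crystallization.Theorems.FrustratedLawDichotomyAtlasDoor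

open MeasureTheory Set Filter
open scoped ENNReal BigOperators
open Summit.AtomisticToContinuum.Crystallization.Theorems.FrustratedLawDichotomySignedLedger (LawLedger aperiodicFrustratedLawGap_of_lawLedger)
open Summit.AtomisticToContinuum.Crystallization.Theorems.FrustratedLawDichotomyMarginLedger (rowCell lawLedgerOfRows)
open Summit.AtomisticToContinuum.Crystallization.Theorems.FrustratedLawDichotomyHardCoreUpgrade (ae_isRootedHardCore_upgrade)

/-- ★ **THE RESIDUAL-CORE DEFICIT HYPOTHESIS of a row atlas** `(n, K, mK)`: for every point-stationary probability law `P` that is almost surely rooted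
`7/10`-hard-core, texture-charged (clause (d) verbatim), Nash at every atom (clause (e) verbatim), almost surely not a periodic translate and MINIMISING
(`E_P[rootEnergy] ≤ e⋆`), the mean deficit of the uncovered roots is below the booked credit of the first-hit cells:
`∫_{(⋃_{i<n} K i)ᶜ} (e⋆ − rootEnergy μ) dP < Σ_{i<n} m_i·P(rowCell K i)`.  (The crux's binder list with `δ = 7/10`, conclusion replaced.) [new: junction] -/
def ResidualCoreDeficit (n : ℕ) (K : ℕ → Set (MeasureTheory.Measure (EuclideanSpace ℝ (Fin 3)))) (mK : ℕ → ℝ) : Prop :=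
  ∀ P : MeasureTheory.Measure (MeasureTheory.Measure (EuclideanSpace ℝ (Fin 3))), let Gy : ℝ → (N : ℕ) → (Fin N → EuclideanSpace ℝ (Fin 3)) → Fin N → Prop := fun η N y j => let d : ℝ := sInf ((fun z => dist z (y (j : Fin N))) '' (Set.range (y) \ {(y (j : Fin N))})); let T : Set (EuclideanSpace ℝ (Fin 3)) := {z : EuclideanSpace ℝ (Fin 3) | z ∈ Set.range (y) ∧ z ≠ (y (j : Fin N)) ∧ dist z (y (j : Fin N)) < 13 / 10 * d}; ∃ A : EuclideanSpace ℝ (Fin 3) →ₗᵢ[ℝ] EuclideanSpace ℝ (Fin 3), (∃ e : ↥T ≃ ↥Literature.Geometry.DiscreteGeometry.fccKissingPattern, ∀ t : ↥T, dist (d⁻¹ • ((t : EuclideanSpace ℝ (Fin 3)) - (y (j : Fin N)))) (A ((e t : ↥Literature.Geometry.DiscreteGeometry.fccKissingPattern) : EuclideanSpace ℝ (Fin 3))) ≤ η) ∨ (∃ e : ↥T ≃ ↥Literature.Geometry.DiscreteGeometry.hcpKissingPattern, ∀ t : ↥T, dist (d⁻¹ • ((t : EuclideanSpace ℝ (Fin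 3)) - (y (j : Fin N)))) (A ((e t : ↥Literature.Geometry.DiscreteGeometry.hcpKissingPattern) : EuclideanSpace ℝ (Fin 3))) ≤ η); let TexBall : (N : ℕ) → (Fin N → EuclideanSpace ℝ (Fin 3)) → Fin N → ℝ → ℝ → ℝ → ℝ → Prop := fun N y i R R₇ R₈ R₉ => (∀ a b : Fin N, a ≠ b → (7 : ℝ) / 10 ≤ dist (y a) (y b)) ∧ (∀ j : Fin N, dist (y j) (y i) ≤ R → ¬ Gy (1 / 20) N (y) j) ∧ (∀ j : Fin N, dist (y j) (y i) ≤ R → ¬ ((∀ j' : Fin N, dist (y j') (y j) ≤ R₇ → ¬ Gy (1 / 20) N (y) j') ∧ (∀ z : EuclideanSpace ℝ (Fin 3), dist z (y j) ≤ R₇ → ∃ k : Fin N, dist z (y k) ≤ 1) ∧ (∀ j' : Fin N, dist (y j') (y j) ≤ R₇ → (let d : ℝ := sInf ((fun z => dist z (y j')) '' (Set.range (y) \ {(y j')})); ∀ k : Fin N, y k ≠ y j' → dist (y k) (y j') < 27 / 20 * d → 5 ≤ Nat.card {m : Fin N // y m ≠ y j' ∧ dist (y m) (y j') < 27 / 20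 * d ∧ y m ≠ y k ∧ dist (y m) (y k) < 27 / 20 * d})))) ∧ (∀ j : Fin N, dist (y j) (y i) ≤ R → ∃ k : Fin N, dist (y k) (y j) ≤ R₈ ∧ Gy (1 / 8) N (y) k) ∧ (∀ j : Fin N, dist (y j) (y i) ≤ R → ¬ ((∀ j' : Fin N, dist (y j') (y j) ≤ R₉ → ¬ Gy (1 / 20) N (y) j') ∧ (Nat.card {j' : Fin N // dist (y j') (y j) ≤ R₉ ∧ ¬ Gy (1 / 8) N (y) j'} : ℝ) ≤ 1 / 2 * (Nat.card {j' : Fin N // dist (y j') (y j) ≤ R₉} : ℝ) ∧ (∀ j' : Fin N, dist (y j') (y j) ≤ R₉ → ¬ Gy (1 / 8) N (y) j' → ¬ (let d : ℝ := sInf ((fun z => dist z (y j')) '' (Set.range (y) \ {(y j')})); ∀ k : Fin N, y k ≠ y j' → dist (y k) (y j') < 27 / 20 * d → 5 ≤ Nat.card {m : Fin N // y m ≠ y j' ∧ dist (y m) (y j') < 27 / 20 * d ∧ y m ≠ y k ∧ dist (y m) (y k) < 27 / 20 * d})))); let Appr : MeasureTheory.Measure (EuclideanSpace ℝ (Fin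 3)) → ℝ → ℝ → ℝ → Prop := fun μ R₇ R₈ R₉ => ∀ q : EuclideanSpace ℝ (Fin 3), μ {q} ≠ 0 → ∀ R ε : ℝ, 0 < ε → ∃ (N : ℕ) (y : Fin N → EuclideanSpace ℝ (Fin 3)) (i : Fin N), TexBall N y i R R₇ R₈ R₉ ∧ (∀ p : EuclideanSpace ℝ (Fin 3), μ {p} ≠ 0 → dist p q ≤ R → ∃ k : Fin N, dist (y k - y i) (p - q) ≤ ε) ∧ (∀ k : Fin N, dist (y k) (y i) ≤ R → ∃ p : EuclideanSpace ℝ (Fin 3), μ {p} ≠ 0 ∧ dist (y k - y i) (p - q) ≤ ε); MeasureTheory.IsProbabilityMeasure P → (∀ᵐ μ ∂P, Literature.Probability.Process.IsRootedHardCore (7 / 10) μ) → Literature.Probability.Process.IsPointStationaryLaw P → (∃ R₇ R₈ R₉ : ℝ, ∀ᵐ μ ∂P, Appr μ R₇ R₈ R₉) → (∀ᵐ μ ∂P, ∀ p : EuclideanSpace ℝ (Fin 3), μ {p} ≠ 0 → ∀ y : EuclideanSpace ℝ (Fin 3), (∀ q : EuclideanSpace ℝ (Fin 3), μ {q} ≠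 0 → q ≠ p → y ≠ q) → ∑' q : {q : EuclideanSpace ℝ (Fin 3) // μ {q} ≠ 0 ∧ q ≠ p}, Literature.MathematicalPhysics.StatisticalMechanics.lennardJones (dist p (q : EuclideanSpace ℝ (Fin 3))) ≤ ∑' q : {q : EuclideanSpace ℝ (Fin 3) // μ {q} ≠ 0 ∧ q ≠ p}, Literature.MathematicalPhysics.StatisticalMechanics.lennardJones (dist y (q : EuclideanSpace ℝ (Fin 3)))) → P {μ : MeasureTheory.Measure (EuclideanSpace ℝ (Fin 3)) | ∃ Q : Literature.MathematicalPhysics.StatisticalMechanics.PeriodicConfiguration 3, ∃ t : EuclideanSpace ℝ (Fin 3), {p : EuclideanSpace ℝ (Fin 3) | μ {p} ≠ 0} = (fun s => s + t) '' Q.points} = 0 → (∫ μ, Literature.MathematicalPhysics.StatisticalMechanics.rootEnergy Literature.MathematicalPhysics.StatisticalMechanics.lennardJones μ ∂P) ≤ (⨅ Q : Literature.MathematicalPhysics.StatisticalMechanics.PeriodicConfiguration 3, Q.energyPerParticle Literature.MathematicalPhysics.StatisticalMechanics.lennardJones) → (∫ μ in (⋃ i ∈ Finset.range n, K i)ᶜ,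 ((⨅ Q : Literature.MathematicalPhysics.StatisticalMechanics.PeriodicConfiguration 3, Q.energyPerParticle Literature.MathematicalPhysics.StatisticalMechanics.lennardJones) - Literature.MathematicalPhysics.StatisticalMechanics.rootEnergy Literature.MathematicalPhysics.StatisticalMechanics.lennardJones μ) ∂P) < ∑ i ∈ Finset.range n, mK i * P.real (rowCell K i)

/-- ★★ **THE ATLAS DOOR (route decl, by name).**  A finite row atlas with deterministic floors at every rooted `7/10`-hard-core Nash configuration of
each row, plus `ResidualCoreDeficit` for it, proves `AperiodicFrustratedLawGap`. [new: junction] -/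
theorem aperiodicFrustratedLawGap_of_atlas (n : ℕ) (K : ℕ → Set (MeasureTheory.Measure (EuclideanSpace ℝ (Fin 3)))) (hK : ∀ i, MeasurableSet (K i)) (mK : ℕ → ℝ)
    (hfloor : ∀ i < n, ∀ μ : MeasureTheory.Measure (EuclideanSpace ℝ (Fin 3)), Literature.Probability.Process.IsRootedHardCore (7 / 10) μ →
      (∀ p : EuclideanSpace ℝ (Fin 3), μ {p} ≠ 0 → ∀ y : EuclideanSpace ℝ (Fin 3), (∀ q : EuclideanSpace ℝ (Fin 3), μ {q} ≠ 0 → q ≠ p → y ≠ q) → ∑' q : {q : EuclideanSpace ℝ (Fin 3) // μ {q} ≠ 0 ∧ q ≠ p}, Literature.MathematicalPhysics.StatisticalMechanics.lennardJones (dist p (q : EuclideanSpace ℝ (Fin 3))) ≤ ∑' q : {q : EuclideanSpace ℝ (Fin 3) // μ {q} ≠ 0 ∧ q ≠ p}, Literature.MathematicalPhysics.StatisticalMechanics.lennardJones (dist y (q : EuclideanSpace ℝ (Fin 3)))) → μ ∈ K i →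
      (⨅ Q : Literature.MathematicalPhysics.StatisticalMechanics.PeriodicConfiguration 3, Q.energyPerParticle Literature.MathematicalPhysics.StatisticalMechanics.lennardJones) + mK i ≤ Literature.MathematicalPhysics.StatisticalMechanics.rootEnergy Literature.MathematicalPhysics.StatisticalMechanics.lennardJones μ)
    (hres : ResidualCoreDeficit n K mK) :
    Summit.AtomisticToContinuum.Crystallization.Theses.FrustratedLawDichotomy.AperiodicFrustratedLawGap := by
  refine aperiodicFrustratedLawGap_of_lawLedger fun δ hδ P => ?_
  have hres' := hres P
  dsimp only at hres' ⊢
  intro hP ha hb hd he h0 hmin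
  have ha' : ∀ᵐ μ ∂P, Literature.Probability.Process.IsRootedHardCore (7 / 10) μ := by
    obtain ⟨R₇, R₈, R₉, hd'⟩ := hd
    refine ae_isRootedHardCore_upgrade ha ?_
    filter_upwards [hd'] with μ hμ q hq R ε hε
    obtain ⟨N, y, i, ⟨hsep, -⟩, hm, -⟩ := hμ q hq R ε hε
    exact ⟨N, y, i, hsep, hm⟩
  have hR := hres' hP ha' hb hd he h0 hmin
  exact ⟨lawLedgerOfRows (by norm_num : (0 : ℝ) < 7 / 10) ha' n K hK mK
    (fun i hi => by
      filter_upwards [ha', he] with μ hμ hN hμi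
      exact hfloor i hi μ hμ hN hμi) hR⟩

end Summit.AtomisticToContinuum.Crystallization.Theorems.FrustratedLawDichotomyAtlasDoor

end
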